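import Summits.Parity.GeneralizedHardyLittlewood.Theorems.LeeYangFibresPrimeCellsRelativeSieveTransfer
import Summits.Parity.GeneralizedHardyLittlewood.Theorems.LeeYangFibresPrimeCellsRelativeWalshExtraction
import Summits.Parity.GeneralizedHardyLittlewood.Theorems.LeeYangFibresPrimeCellsRelativeSingletonClassSums
import Summits.Parity.GeneralizedHardyLittlewood.Theorems.LeeYangFibresPrimeCellsRelativeWeightedFromMeanPos
import Summits.Parity.GeneralizedHardyLittlewood.Theorems.LeeYangFibresPrimeCellsRelativeChowlaClipsParityPos
import Summits.Parity.GeneralizedHardyLittlewood.Theorems.LeeYangFibresAbsoluteUpgradeRoughAnatomy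
import Summits.Parity.GeneralizedHardyLittlewood.Theorems.LeeYangFibresModelCellFacts
import Summits.Parity.GeneralizedHardyLittlewood.Theorems.LeeYangFibresCellsToRelativeDimOne
import Summits.Parity.GeneralizedHardyLittlewood.Theorems.LeeYangFibresPrimeCellsRelativeLocator
import HarnessLib

/-!
# Route `LeeYangFibres`, crux `PrimeCellsRelative` (stmt-Parity-14112), line `SketchIdeator4`
# (card `sieve-out-to-chowla`): the line's theorem — a second in-arrow to the node

Composition BY NAME of the five landed provable stubs of the line (`stub_sieveTransfer` p118887, `stub_walshExtraction`
p118325, `stub_singletonClassSums` p117580, `stub_weightedFromMeanPos` p119356, `stub_chowlaClipsParityPos` p119358) with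
the landed `stub_roughAnatomy` (sibling crux, p97352) and the proved `modelCellFacts_proof` (item stmt-Parity-14111):

* `primeCellsRelative_of_cellParityLaw_of_liouvilleTupleMeanPos` — **`CellParityLaw ∧ (∀ t ≥ 2, LiouvilleTupleMeanPos t)
  ⟹ PrimeCellsRelative`**: the route's crux 3 (Bombieri's multi-character cell parity law) together with a
  Bombieri–Vinogradov mean value for `k`-point Liouville correlations along the system at level `N^η` (natural density,
  positive forms, no primes) imply the counting Dickson–Hardy–Littlewood law for the joint rough prime cell with
  Green–Tao's relative + absolute error.  This is the second in-arrow to the node `PrimeCellsRelative`, parallel to the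
  proved `HyperbolicityClipsParity` (`CellParityLaw ∧ FibreHyperbolicity ⟹ PrimeCellsRelative`,
  `Cruxes.PrimeCellsRelative.Sketch.primeCellsRelative_of_cellParityLaw_of_fibreHyperbolicity`, p96058): it reaches the
  node WITHOUT the zero-locus hypothesis.
* corollaries along the proved glue: the same hypotheses give `RelativeDimOne` (the `closes` hypothesis of the route,
  via `cellsToRelativeDimOne_proof`, item stmt-Parity-14115) and `TwinPrimeConjecture`
  (via `Sketch.primeCellsRelative_implies_twinPrimeConjecture`, p89136).

Both hypotheses are conjecture-grade and neither implies the node by itself (the law admits every parity ghost; the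
Liouville mean mentions no prime); the crux item stays open (it closes when stmt-Parity-14109 closes AND
`LiouvilleTupleMeanPos` is proved).  References: Bombieri 1976 [BombieriAsymptoticSieve1976]; Green–Tao 2010 Conj. 1.4
[GreenTao2010]; Tao 2016 [TaoFMP2016] (species of the parity input).
-/

noncomputable section

namespace Summit.Parity.GeneralizedHardyLittlewood.Cruxes.PrimeCellsRelative.SieveOutToChowla

open Summit.Parity.GeneralizedHardyLittlewood.Theses.LeeYangFibres

/-- **The line's theorem (registered sub-goal of stmt-Parity-14112).** Bombieri's cell parity law for the joint rough
cells of a one-dimensional system (route crux 3, `CellParityLaw`) and the Bombieri–Vinogradov mean value for `k`-point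
Liouville correlations along the system on positive intervals (`LiouvilleTupleMeanPos t`, `t ≥ 2`) imply
`PrimeCellsRelative`.  Proof: the landed composition `stub_chowlaClipsParityPos` fed with the landed `stub_sieveTransfer`,
`stub_walshExtraction`, `stub_singletonClassSums`, `stub_weightedFromMeanPos ∘ (the hypothesis)`, `stub_roughAnatomy` and
`modelCellFacts_proof`. [folklore] -/
theorem primeCellsRelative_of_cellParityLaw_of_liouvilleTupleMeanPos : CellParityLaw → (∀ t : ℕ, 2 ≤ t → LiouvilleTupleMeanPos t) → PrimeCellsRelative :=
  fun hLaw hChowla =>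
    stub_chowlaClipsParityPos stub_sieveTransfer stub_walshExtraction stub_singletonClassSums
      (fun t ht => stub_weightedFromMeanPos t (hChowla t ht))
      Summit.Parity.GeneralizedHardyLittlewood.Theorems.AbsoluteUpgrade.stub_roughAnatomy
      Summit.Parity.GeneralizedHardyLittlewood.Theorems.modelCellFacts_proof hLaw

/-- **Corollary: the route's `closes` hypothesis from the same inputs.** `CellParityLaw ∧ (∀ t ≥ 2, LiouvilleTupleMeanPos t)
⟹ RelativeDimOne`, through the proved glue `CellsToRelativeDimOne` (item stmt-Parity-14115). [folklore] -/
theorem relativeDimOne_of_cellParityLaw_of_liouvilleTupleMeanPos (hLaw : CellParityLaw)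
    (hChowla : ∀ t : ℕ, 2 ≤ t → LiouvilleTupleMeanPos t) : RelativeDimOne :=
  Summit.Parity.GeneralizedHardyLittlewood.Theorems.LeeYangFibresCells.cellsToRelativeDimOne_proof
    (primeCellsRelative_of_cellParityLaw_of_liouvilleTupleMeanPos hLaw hChowla)

/-- **Corollary: twin primes from the same inputs** (through `PrimeCellsRelative ⟹ TwinPrimeConjecture`, p89136).
[folklore] -/
theorem twinPrimeConjecture_of_cellParityLaw_of_liouvilleTupleMeanPos (hLaw : CellParityLaw)
    (hChowla : ∀ t : ℕ, 2 ≤ t → LiouvilleTupleMeanPos t) : Literature.NumberTheory.Sieve.TwinPrimeConjecture :=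
  Cruxes.PrimeCellsRelative.Sketch.primeCellsRelative_implies_twinPrimeConjecture
    (primeCellsRelative_of_cellParityLaw_of_liouvilleTupleMeanPos hLaw hChowla)

end Summit.Parity.GeneralizedHardyLittlewood.Cruxes.PrimeCellsRelative.SieveOutToChowla

end
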